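import Summits.CriticalPhenomena.PercolationContinuityZ3.Theorems.PercNearOneGluingNoHeavyQuantGluedLemmaW
import HarnessLib

/-!
# QUANT lane R8, T-DEC: the CHEAP-ATOM POOL BOUND for the glued-piece slice — cheapness of an atom `c` w.r.t. a low `l*` makes the
# GIANT copies behave like a pseudo-mid: every low `w` compatible with `c` satisfies `α w ≤ usage(w, c)·P` for the least giant price `P`
# (arm-1 gen 59, architect; step (C) of the dual proof of `GluedLemmaW`'s pair condition)

builds on p205010 (kernel theorem, internal audit signed; external expert review pending)

Support file (`--supports stmt-CriticalPhenomena-4575`), QUANT lane seat prim-quant-arm-1 (gen 59, architect); memo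
`run/shared/lean/prim/quant/prim-quant-arm-1-g59/ARCH-G59.md` §2.  Theorems only; standard axioms, no sorries, no definitions.

WHY (memo §1–§2).  Arm-1 g58 typed the light-window residue of the single-layer route as the flow conjecture `LawDec.GluedLemmaW` and
proved its USE (`gluedPullback_windowPair_of_lemmaW`): for a price system `(α, p)` of the image `ν = (β ∗ t)`-positions at `(y, T, j)` and a
light window pair `(l, h)` below an atom `c ∈ [h, min(j,B)]` that is CHEAP w.r.t. a low `l*` (`−Ψ(c)·y < (1−y)·Ψ(l*)`, `Ψ` the pullback),
the pair condition `(1−γ)Ψ(l) + γΨ(h) ≤ 0`.  By LP duality the flow statement and this dual statement are equivalent configuration by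
configuration; the dual one can be attacked directly, and its first step is mechanical and general — this file:
* `coefAt_le_giant` — every signed coefficient is `≤ y/(1−y)·p G` for every giant `G` (`j < G ≤ M`): lows ship to giants at the floor rate
  (`usage_giant_eq`), non-lows have coefficient `−p ≤ 0`;  `gluedPullback_le_giant` — hence `Ψ(v) ≤ y/(1−y)·p G` for EVERY position `v`.
* `cheap_neg_pullback_lt` — so cheapness of `c` w.r.t. ANY low gives `−Ψ(c) < P` for every giant price `P` (and their minimum): the
  `t`-average `t₀p(c) + t₁p(c+r) + t₂p(c+r+k)` of the prices of `c`'s copies is below the cheapest giant.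
* **`pool_bound`** (THE CHEAP PSEUDO-MID): if moreover `p(c+r+k) ≥ P` and (`c + r` is a giant with `p(c+r) ≥ P`, or `c + r ≤ j` is a mid), then
  every low `w` compatible with `c` has `α w ≤ usage(w, c)·P` — average the mid bounds `α w ≤ usage(w,c)p(c)`, `α w ≤ usage(w,c+r)p(c+r) ≤
  usage(w,c)p(c+r)` (`usage_anti_mid`) with the weights `t₀, t₁`.  Since `usage(w, c) ≤ usage(w, h)` for `c ≥ h`, the giant copies of `h`
  (price `≥ P`) absorb the copies of the low atom `l` at the rate `min(y/(1−y), usage(·, h))`: exactly undoing the window damage "the light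
  absorber's top copy becomes a giant, dearer than the light mid rate" (ARCH-G58 §0 (4a)) — up to the two-column criterion of
  `…QuantGluedWindowIneq` (step (T)).

HONEST STATUS.  `GluedLemmaW`, `GluedDominatedMass`, the band, `SiblingStep`, `FarTreeRow` OPEN; RATE class (log\*) / honest sentence of
`run/shared/lean/prim/quant/README.md` unchanged.  [this work].  Nothing here is cited as a published result.  The gluing rows served
[cite: KozmaNitzan2024, Conjecture 3 (p. 15)]; product measure [cite: Grimmett1999, §1.3 p. 10].
-/

noncomputable section

open scoped BigOperators

namespace Summit.CriticalPhenomena.PercolationContinuityZ3.Theorems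
namespace Quant

open Finset

namespace LawDec

/-- a price system bounds EVERY signed coefficient by the giant rate times any giant's price: `coefAt T j α p v ≤ y/(1−y)·p G` for
`j + 1 ≤ G ≤ M` (a low `v` ships to the giant `G` at usage `y/(1−y)`; a non-low `v` has coefficient `−p v ≤ 0`). [this work] -/
theorem coefAt_le_giant (y T : ℝ) (j M : ℕ) (α p : ℕ → ℝ) (hy0 : 0 < y) (hy1 : y < 1) (hp : ∀ h, 0 ≤ p h)
    (hαp : ∀ l h, l ≤ j → 2 * (l : ℝ) < T → h ≤ M → (j + 1 ≤ h ∨ T < (l : ℝ) + h) → α l ≤ usage y T j l h * p h)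
    (v G : ℕ) (hGj : j + 1 ≤ G) (hGM : G ≤ M) :
    coefAt T j α p v ≤ y / (1 - y) * p G := by
  unfold coefAt
  split_ifs with hv
  · have := hαp v G hv.1 hv.2 hGM (Or.inl hGj)
    rwa [usage_giant_eq y T j v G hGj] at this
  · have : 0 ≤ y / (1 - y) * p G := mul_nonneg (div_nonneg hy0.le (by linarith)) (hp G)
    linarith [hp v]

/-- hence the pullback of any position is at most `y/(1−y)` times any giant's price. [this work] -/
theorem gluedPullback_le_giant (y T q g : ℝ) (j r k M : ℕ) (α p : ℕ → ℝ) (hy0 : 0 < y) (hy1 : y < 1) (hq0 : 0 ≤ q) (hq1 : q ≤ 1)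
    (hg0 : 0 ≤ g) (hg1 : g ≤ 1) (hp : ∀ h, 0 ≤ p h)
    (hαp : ∀ l h, l ≤ j → 2 * (l : ℝ) < T → h ≤ M → (j + 1 ≤ h ∨ T < (l : ℝ) + h) → α l ≤ usage y T j l h * p h)
    (v G : ℕ) (hGj : j + 1 ≤ G) (hGM : G ≤ M) :
    gluedPullback T q g j r k α p v ≤ y / (1 - y) * p G := by
  unfold gluedPullback
  have h0 := coefAt_le_giant y T j M α p hy0 hy1 hp hαp v G hGj hGM
  have h1 := coefAt_le_giant y T j M α p hy0 hy1 hp hαp (v + r) G hGj hGM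
  have h2 := coefAt_le_giant y T j M α p hy0 hy1 hp hαp (v + r + k) G hGj hGM
  have t0 : 0 ≤ 1 - q := by linarith
  have t1 : 0 ≤ q * (1 - g) := mul_nonneg hq0 (by linarith)
  have t2 : 0 ≤ q * g := mul_nonneg hq0 hg0
  have e : (1 - q) + q * (1 - g) + q * g = 1 := by ring
  nlinarith [mul_le_mul_of_nonneg_left h0 t0, mul_le_mul_of_nonneg_left h1 t1, mul_le_mul_of_nonneg_left h2 t2]

/-- **THE CHEAP-ATOM PRICE BOUND.**  If `c` is cheap w.r.t. `ls` (`−Ψ(c)·y < (1−y)·Ψ(ls)`) and `Ψ(ls) ≤ y/(1−y)·P` (e.g. `P` the least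
price among some giants, `gluedPullback_le_giant`), then `−Ψ(c) < P`. [this work] -/
theorem cheap_neg_pullback_lt (y : ℝ) (Ψc Ψls P : ℝ) (hy0 : 0 < y) (hy1 : y < 1) (hcheap : -Ψc * y < (1 - y) * Ψls)
    (hls : Ψls ≤ y / (1 - y) * P) : -Ψc < P := by
  have h1y : 0 < 1 - y := by linarith
  have : (1 - y) * Ψls ≤ y * P := by
    have := mul_le_mul_of_nonneg_left hls h1y.le
    rwa [← mul_assoc, mul_div_cancel₀ _ h1y.ne'] at this
  nlinarith

/-- **THE POOL BOUND (cheap pseudo-mid).**  With `t = (1−q, q(1−g), qg)` and non-low copies `c, c+r, c+r+k` of the cheap atom: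
if `t₀ p(c) + t₁ p(c+r) + t₂ p(c+r+k) < P`, `p(c+r+k) ≥ P`, and either `c + r` is a giant with `p(c+r) ≥ P` or `c + r ≤ j` is a mid,
then every low `w` compatible with `c` (`T < w + c`, `c ≤ j`) satisfies `α w ≤ usage(w, c)·P`. [this work] -/
theorem pool_bound (y T q g P : ℝ) (j M c r k w : ℕ) (α p : ℕ → ℝ) (hy0 : 0 < y) (hy1 : y < 1) (hq0 : 0 ≤ q) (hq1 : q ≤ 1)
    (hg0 : 0 ≤ g) (hg1 : g ≤ 1) (hp : ∀ h, 0 ≤ p h)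
    (hαp : ∀ l h, l ≤ j → 2 * (l : ℝ) < T → h ≤ M → (j + 1 ≤ h ∨ T < (l : ℝ) + h) → α l ≤ usage y T j l h * p h)
    (hwj : w ≤ j) (hwlow : 2 * (w : ℝ) < T) (hcomp : T < (w : ℝ) + c) (hcrM : c + r ≤ M) (hr : 1 ≤ r)
    (havg : (1 - q) * p c + q * (1 - g) * p (c + r) + q * g * p (c + r + k) < P) (htop : P ≤ p (c + r + k))
    (hC1 : j + 1 ≤ c + r ∧ P ≤ p (c + r) ∨ c + r ≤ j) :
    α w ≤ usage y T j w c * P := by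
  have hwc : w < c := by
    have : (w : ℝ) < c := by linarith
    exact_mod_cast this
  have hκ0 : 0 ≤ usage y T j w c := (usage_pos_of_compat y T j w c hy0 hy1 hwlow hwc (Or.inr hcomp)).le
  have t1nn : 0 ≤ q * (1 - g) := mul_nonneg hq0 (by linarith)
  have t2nn : 0 ≤ q * g := mul_nonneg hq0 hg0
  -- the bound through c itself
  have bc : α w ≤ usage y T j w c * p c := hαp w c hwj hwlow (le_trans (by omega) hcrM) (Or.inr hcomp)
  rcases hC1 with ⟨hgi, hP1⟩ | hmid
  · -- c + r giant: t₀ p(c) < t₀ P (using p(c+r), p(c+r+k) ≥ P), and t₀ > 0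
    have ht0P : (1 - q) * p c < (1 - q) * P := by nlinarith [mul_le_mul_of_nonneg_left hP1 t1nn, mul_le_mul_of_nonneg_left htop t2nn]
    have ht0 : 0 < 1 - q := by
      by_contra hc0
      have : 1 - q = 0 := le_antisymm (not_lt.mp hc0) (by linarith)
      rw [this] at ht0P; simp at ht0P
    have : p c < P := lt_of_mul_lt_mul_left ht0P ht0.le
    nlinarith [mul_le_mul_of_nonneg_left this.le hκ0]
  · -- c + r mid: α w ≤ usage(w,c+r) p(c+r) ≤ usage(w,c) p(c+r); average the two bounds with weights t₀, t₁
    have hcomp1 : T < (w : ℝ) + (c + r : ℕ) := by push_cast; have : (0:ℝ) ≤ r := Nat.cast_nonneg r; linarith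
    have bc1 : α w ≤ usage y T j w (c + r) * p (c + r) := hαp w (c + r) hwj hwlow hcrM (Or.inr hcomp1)
    have anti : usage y T j w (c + r) ≤ usage y T j w c :=
      usage_anti_mid y T j w c (c + r) hy0 hy1 (by omega) hmid hwlow hcomp
    have bc1' : α w ≤ usage y T j w c * p (c + r) := le_trans bc1 (mul_le_mul_of_nonneg_right anti (hp _))
    have havg' : (1 - q) * p c + q * (1 - g) * p (c + r) < ((1 - q) + q * (1 - g)) * P := by
      nlinarith [mul_le_mul_of_nonneg_left htop t2nn]
    have hs : 0 < (1 - q) + q * (1 - g) := by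
      by_contra hc0
      have hz : (1 - q) + q * (1 - g) = 0 := le_antisymm (not_lt.mp hc0) (by positivity)
      rw [hz] at havg'
      have : 0 ≤ (1 - q) * p c + q * (1 - g) * p (c + r) := by
        have := hp c; have := hp (c + r); positivity
      linarith
    have key : ((1 - q) + q * (1 - g)) * α w ≤ usage y T j w c * ((1 - q) * p c + q * (1 - g) * p (c + r)) := by
      nlinarith [mul_le_mul_of_nonneg_left bc (show (0:ℝ) ≤ 1 - q by linarith), mul_le_mul_of_nonneg_left bc1' t1nn]
    have : ((1 - q) + q * (1 - g)) * α w ≤ ((1 - q) + q * (1 - g)) * (usage y T j w c * P) := by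
      nlinarith [mul_le_mul_of_nonneg_left havg'.le hκ0]
    exact le_of_mul_le_mul_left this hs

end LawDec
end Quant
end Summit.CriticalPhenomena.PercolationContinuityZ3.Theorems
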